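import Mathlib.Algebra.Module.CharacterModule
import Mathlib.Data.Finset.Order
import HarnessLib

/-!
# The Pontryagin dual of a DIRECTED union: characters of `⋃_i S i` are compatible families of
# characters of the `S i` (carrier-free companion of `CharacterModuleDirectedUnion.lean` and
# `DirectedSystemLifting.lean`)

For an abelian group `G` exhausted by a family of subgroups `S i` indexed by a DIRECTED preorder and
monotone in `i` (`⋃_i S i = G`), the character group `G⋆ = Hom(G, ℚ/ℤ)` (Mathlib `CharacterModule G`;
Weibel Def. 3.2.3) "is" the inverse limit of the `(S i)⋆` along restriction — Weibel Variation 2.6.9 /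
Thm. 2.6.10, `Hom(colim_i S i, ℚ/ℤ) = lim_i Hom(S i, ℚ/ℤ)` — stated WITHOUT a limit object, in the
compatible-family currency of `DirectedSystemLifting.lean`:

* `characterModule_ext_of_directed_iUnion` — a character of `G` is determined by its restrictions;
* `exists_characterModule_of_compatible` / `existsUnique_characterModule_of_compatible` — a family of
  characters `χ i : (S i)⋆`, compatible under restriction along `S i ≤ S j` (`i ≤ j`), GLUES to a unique
  character of `G` (no divisibility of `ℚ/ℤ` needed: directedness gives common indices);
* `characterModule_restrict_surjective` — restriction `(S j)⋆ → (S i)⋆` is onto (`ℚ/ℤ` injective,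
  Weibel Cor. 2.3.3; Mathlib `CharacterModule.dual_surjective_of_injective`), so the dual system has
  surjective transition maps.

Case of use: the discrete Selmer group over a `ℤ_p`-tower as the union over `(n, m) ∈ ℕ × ℕ` of the
images of the finite-level groups `Sel_{p^m}(E/K_n)`, whose dual `X = Hom(Sel, ℚ/ℤ)` (the tree's
`AcSigned.X`, `Kobayashi2003.SignedSelmerDualData`, …) is then read as the system of finite-level duals.
All statements are proved; no named facts; no definitions; nothing asserted about arithmetic objects.

References: [Weibel1994] Def. 3.2.3, Cor. 2.3.3, Variation 2.6.9 / Thm. 2.6.10; [AtiyahMacdonald1969]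
Ch. 2, Ex. 2.14–2.19 (direct limits over directed sets as unions; their universal property).
-/

namespace Literature.Algebra.InverseSystem

universe u v

open Function

section DirectedUnion

variable {ι : Type u} [Preorder ι] [IsDirectedOrder ι] {G : Type v} [AddCommGroup G]
  (S : ι → AddSubgroup G) (hS : Monotone S)

omit [IsDirectedOrder ι] in
/-- **Restriction of characters along `S i ≤ S j` is surjective** (`ℚ/ℤ` is divisible, hence an
injective `ℤ`-module: Mathlib `CharacterModule.dual_surjective_of_injective`); so the dual system
`i ↦ (S i)⋆` of an increasing family has SURJECTIVE transition maps. [cite: Weibel1994, Cor. 2.3.3 and Lemma 3.5.3] -/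
theorem characterModule_restrict_surjective {i j : ι} (h : i ≤ j) (χ : CharacterModule (S i)) :
    ∃ ψ : CharacterModule (S j), ∀ x : S i, ψ (AddSubgroup.inclusion (hS h) x) = χ x := by
  obtain ⟨ψ, hψ⟩ := CharacterModule.dual_surjective_of_injective
    ((AddSubgroup.inclusion (hS h)).toIntLinearMap) (AddSubgroup.inclusion_injective (hS h)) χ
  exact ⟨ψ, fun x ↦ by rw [← hψ]; rfl⟩

variable (hU : ∀ g : G, ∃ i, g ∈ S i)
include hU

omit [Preorder ι] [IsDirectedOrder ι] in
/-- **A character of `G = ⋃_i S i` is determined by its restrictions to the `S i`.**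
[cite: Weibel1994, Variation 2.6.9 / Thm. 2.6.10 (`Hom(colim A_i, B) = lim Hom(A_i, B)`, injectivity)] -/
theorem characterModule_ext_of_directed_iUnion {χ ψ : CharacterModule G}
    (h : ∀ (i : ι) (x : S i), χ (x : G) = ψ (x : G)) : χ = ψ := by
  refine CharacterModule.ext _ fun g ↦ ?_
  obtain ⟨i, hi⟩ := hU g
  exact h i ⟨g, hi⟩

include hS

/-- **Compatible families of characters glue** (surjectivity half of `Hom(colim_i S i, ℚ/ℤ) =
lim_i Hom(S i, ℚ/ℤ)` for a DIRECTED union): if `χ i : (S i)⋆` satisfy `χ j|_{S i} = χ i` whenever `i ≤ j`,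
there is a character `χ` of `G = ⋃_i S i` restricting to every `χ i`. The value at `g` is `χ i ⟨g, _⟩`
for any `i` with `g ∈ S i` — independent of `i` because two such indices have a common upper bound
(directedness) — and additivity holds on a common index for `g, h, g + h`. No divisibility is used.
[cite: Weibel1994, Variation 2.6.9 / Thm. 2.6.10] [cite: AtiyahMacdonald1969, Ch. 2, Ex. 2.16 (universal property of the direct limit)] -/
theorem exists_characterModule_of_compatible (χ : ∀ i, CharacterModule (S i))
    (hχ : ∀ ⦃i j : ι⦄ (h : i ≤ j) (x : S i), χ j (AddSubgroup.inclusion (hS h) x) = χ i x) :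
    ∃ ψ : CharacterModule G, ∀ (i : ι) (x : S i), ψ (x : G) = χ i x := by
  classical
  -- a chosen index for every element, and the glued value
  let ι' : G → ι := fun g ↦ Classical.choose (hU g)
  have hι' : ∀ g, g ∈ S (ι' g) := fun g ↦ Classical.choose_spec (hU g)
  let val : G → AddCircle (1 : ℚ) := fun g ↦ χ (ι' g) ⟨g, hι' g⟩
  -- independence of the index
  have hval : ∀ (g : G) (i : ι) (hi : g ∈ S i), val g = χ i ⟨g, hi⟩ := by
    intro g i hi
    obtain ⟨u, hu1, hu2⟩ := directed_of (· ≤ ·) (ι' g) i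
    have h1 := hχ hu1 ⟨g, hι' g⟩
    have h2 := hχ hu2 ⟨g, hi⟩
    change χ (ι' g) ⟨g, hι' g⟩ = _
    rw [← h1, ← h2]
    rfl
  refine ⟨{ toFun := val, map_zero' := ?_, map_add' := fun g h ↦ ?_ }, fun i x ↦ ?_⟩
  · obtain ⟨i⟩ : Nonempty ι := ⟨ι' 0⟩
    rw [hval 0 i (zero_mem _)]
    exact map_zero _
  · -- a common index for `g`, `h` (hence for `g + h`)
    obtain ⟨u, hug, huh⟩ := directed_of (· ≤ ·) (ι' g) (ι' h)
    have hg : g ∈ S u := hS hug (hι' g)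
    have hh : h ∈ S u := hS huh (hι' h)
    rw [hval g u hg, hval h u hh, hval (g + h) u (add_mem hg hh), ← map_add]
    rfl
  · exact hval (x : G) i x.2

/-- **`Hom(⋃_i S i, ℚ/ℤ) ≅ {compatible families of Hom(S i, ℚ/ℤ)}`** for a directed union, in
carrier-free form: every compatible family of characters is the family of restrictions of a UNIQUE
character of `G`. [cite: Weibel1994, Variation 2.6.9 / Thm. 2.6.10 and Def. 3.2.3] -/
theorem existsUnique_characterModule_of_compatible (χ : ∀ i, CharacterModule (S i))
    (hχ : ∀ ⦃i j : ι⦄ (h : i ≤ j) (x : S i), χ j (AddSubgroup.inclusion (hS h) x) = χ i x) :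
    ∃! ψ : CharacterModule G, ∀ (i : ι) (x : S i), ψ (x : G) = χ i x := by
  obtain ⟨ψ, hψ⟩ := exists_characterModule_of_compatible S hS hU χ hχ
  refine ⟨ψ, hψ, fun ψ' hψ' ↦ ?_⟩
  exact characterModule_ext_of_directed_iUnion S hU fun i x ↦ by rw [hψ' i x, hψ i x]

end DirectedUnion

end Literature.Algebra.InverseSystem
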